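import Literature.Analysis.FluidPDE.MildL3RestartAveraging
import Literature.Analysis.FluidPDE.NSBoundedMildOseenClassical
import Literature.Analysis.FluidPDE.KatoLocalBoundedPicard
import Literature.Analysis.FluidPDE.OseenHeatDuality
import Literature.Analysis.FluidPDE.HeatFlowLpClass
import Literature.Analysis.FluidPDE.MildL3Restart
import Literature.Analysis.FluidPDE.NSBoundedMildSmoothing
import Literature.Analysis.FluidPDE.NSBoundedMildOseenRestart
import HarnessLib

/-!
# `classical_of_bounded_mild_L3` from KNSS's smoothing of bounded mild solutions

Analysis/FluidPDE reduction file for the named fact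
`Literature.Analysis.FluidPDE.classical_of_bounded_mild_L3` (`MildL3Smooth.lean`: a mild
solution in `C([0,T); L³)` in the tree's duality form, essentially bounded on every interior
strip `(δ, T₁) × ℝ³`, has a classical representative `(w, π)` on `(0, T)`; Lemarié-Rieusset 2016,
Thm. 9.12; Giga 1986, Rem. after Thm. 4; Koch–Nadirashvili–Seregin–Šverák 2009, Prop. 4.1). It
**proves** the implication

  `knss2009_smoothing ℝ³ → classical_of_bounded_mild_L3`
  (`classical_of_bounded_mild_L3_of_knss2009_smoothing`),

where `knss2009_smoothing` (`NSBoundedMildOseen.lean`, fact (P): KNSS 2009, Prop. 4.1) is the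
smoothing of bounded solutions of the Oseen integral equation
`u(t) = e^{ν(t-s)Δ}a - B^ν_s(u,u)(t)`, `B^ν_s = oseenDuhamel ν s`, itself reduced in the tree to the
local theory (L) `knss2009_local_smoothing` (`NSBoundedMildSmoothing.lean`,
`knss2009_smoothing_of_local`, with the restart fact (R) discharged by `oseenMild_restart_holds`,
`NSBoundedMildOseenRestart.lean`); hence also

  `knss2009_local_smoothing ℝ³ → classical_of_bounded_mild_L3`
  (`classical_of_bounded_mild_L3_of_local`),

so that the dependency record of the fact is the single named fact (L). Everything else on the
path is in the tree and is assembled here: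

1. **Restart at the duality level** (`mild_L3_restart_holds`, `MildL3RestartAveraging.lean`): the
   two-time identities `Fluid.IsMildNSSolutionBetween ν 0 v s t`, `0 ≤ s ≤ t < T`.
2. **Identification with the Oseen representative in `L³`**
   (`ae_eq_heatExtension_sub_oseenDuhamel_of_memLp_three`, proved here, any dimension): on a
   window `(s, T₁)` where `v` is essentially bounded, `v(t) = e^{ν(t-s)Δ}v(s) - B^ν_s(v,v)(t)` a.e.
   — the difference is in `L³` (the Duhamel term by `exists_eLpNorm_oseenDuhamel_le_left`), weakly
   divergence free (`isWeaklyDivFree_oseenDuhamel`, `IsWeaklyDivFree.heatExtension_of_memLp`) and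
   orthogonal to solenoidal tests (the duality identity at `t`, `integral_inner_heatExtension_comm`,
   `integral_inner_oseenDuhamel_eq_neg_intervalIntegral`), hence zero by the Helmholtz–Weyl
   annihilator lemma in `L³` (Lemarié-Rieusset 2016, Thm. 6.1 with Prop. 6.5 and Lemma 6.4 (B):
   in `L³` no harmonic drift survives — contrast KNSS's Lemma 3.1 for merely bounded fields).
3. **(P)** on every window `(s, T₁)`, `0 < s`, with the bounded datum `v(s)`: the representatives
   `w_s(t) = e^{ν(t-s)Δ}v(s) - B^ν_s(v,v)(t)` are jointly smooth; continuous slices a.e. equal to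
   `v(t)` coincide, so `v'(t) = w_{t/2}(t)` is jointly smooth on `(0, T) × ℝ³` with `v'(t) = v(t)`
   a.e. (the gluing of `knss_classical_of_bounded_isBesovMildSolutionOn_of_oseen`,
   `NSBoundedMildOseen.lean`, verbatim).
4. **The momentum equation against solenoidal tests** at each `t₀ ∈ (0, T)`: `v` is not bounded
   near `t = 0`, so fact (C) (`classical_of_smooth_isMildNSSolutionOn_holds`,
   `NSBoundedMildOseenClassical.lean`) is applied to the **time-shifted** field `v'(· + δ)` on
   `(0, T - δ)`, `δ = t₀/2` — a smooth, interior-bounded duality-form mild solution from the datum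
   `v(δ) ∈ L³` (`isMildNSSolutionOn_translate_of_restart`), which is integrable against Gaussians
   — and the resulting classical momentum equation at `t₀ - δ`, tested with a solenoidal `φ`
   (the pressure gradient pairs to zero, `integral_fderiv_apply_eq_zero_of_isDivFree_test`), is the
   tested equation for `v'` at `t₀` (time derivatives within open time sets are local).
5. **The pressure on all of `(0, T)`** by `exists_isClassicalNSSolutionOn_of_forall_integral_inner_eq_zero`
   (`PressureReconstruction.lean`).

## Mathlib / tree search

Tree: `classical_of_bounded_mild_L3`, `isMildNSSolutionOn_translate_of_restart` (`MildL3Smooth`);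
`mild_L3_restart_holds` (`MildL3RestartAveraging`); `knss2009_smoothing`, `oseenDuhamel`,
`IsMildNSSolutionOn.congr_ae_Ioo` (`NSBoundedMildOseen`); `knss2009_local_smoothing`,
`knss2009_smoothing_of_local` (`NSBoundedMildSmoothing`); `oseenMild_restart_holds`
(`NSBoundedMildOseenRestart`; the same one-line reduction of (P) to (L) on `ℝ³` is
`knss2009_smoothing_three_of_local`, `NSBoundedMildOseenAssembly.lean`, not imported here to keep
the GKP/Besov assembly out of this file's closure); `integral_inner_oseenDuhamel_eq_neg_intervalIntegral`,
`isWeaklyDivFree_oseenDuhamel`, `aestronglyMeasurable_oseenDuhamel`, `oseenDuhamel_congr_ae_slice`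
(`NSBoundedMildOseenDuhamel`); `exists_eLpNorm_oseenDuhamel_le_left` (`KatoLocalBoundedPicard`);
`classical_of_smooth_isMildNSSolutionOn_holds` (`NSBoundedMildOseenClassical`);
`integral_fderiv_apply_eq_zero_of_isDivFree_test` (`OseenHeatDuality`);
`IsWeaklyDivFree.heatExtension_of_memLp` (`HeatFlowLpClass`); `integral_inner_heatExtension_comm`,
`holderTriple_three_threeHalves_one` (`MildL3Restart`); `continuous_radialRetract`,
`radialRetract_eq_self` (`BoundedRepresentative`); `IsSmoothSpaceTimeOn.comp_add_right`
(`ClassicalSolutionGlue`); `exists_isClassicalNSSolutionOn_of_forall_integral_inner_eq_zero`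
(`PressureReconstruction`). Mathlib: `derivWithin_of_isOpen`, `deriv_comp_add_const`,
`contDiffOn_of_locally_contDiffOn`, `eq_of_ae_eq_of_continuous` (tree), `measure_singleton`.

## References

* P. G. Lemarié-Rieusset, *The Navier–Stokes Problem in the 21st Century*, CRC Press 2016, Thm. 6.1,
  Prop. 6.5, Lemma 6.4 (pp. 132–136); Thm. 9.12 (pp. 260–263); proof of Thm. 15.1 (A) (p. 565).
  [LemarieRieusset2016]
* G. Koch, N. Nadirashvili, G. Seregin, V. Šverák, Acta Math. 203 (2009) = arXiv:0709.3599, §4,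
  Prop. 4.1. [KochNadirashviliSereginSverak2009]
* Y. Giga, J. Differential Equations 62 (1986), Thm. 4 and the Remark after it (p. 202). [Giga1986]
-/

noncomputable section

open MeasureTheory TopologicalSpace Set Function Filter
open _root_.Topology
open scoped InnerProductSpace RealInnerProductSpace ENNReal NNReal Laplacian

namespace Literature.Analysis.FluidPDE

/-! ## Identification with the Oseen representative in the bounded `L³` class -/

section Identification

variable {E : Type*} [NormedAddCommGroup E] [InnerProductSpace ℝ E] [FiniteDimensional ℝ E]
  [MeasurableSpace E] [BorelSpace E]

/-- The sum of weakly divergence-free `Lᵖ`, `L^q` fields (`1 ≤ p, q`) is weakly divergence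
free (linearity of the weak identity). [folklore] -/
theorem IsWeaklyDivFree.add_of_memLp' {p q : ℝ≥0∞} (hp : 1 ≤ p) (hq : 1 ≤ q) {u v : E → E}
    (hu : IsWeaklyDivFree u) (hv : IsWeaklyDivFree v) (hum : MemLp u p volume)
    (hvm : MemLp v q volume) : IsWeaklyDivFree (u + v) := by
  intro θ hθ
  have hgc : Continuous (gradient θ) :=
    (InnerProductSpace.toDual ℝ E).symm.continuous.comp (hθ.contDiff.continuous_fderiv (by simp))
  have hgs : HasCompactSupport (gradient θ) :=
    (hθ.hasCompactSupport.fderiv (𝕜 := ℝ)).comp_left (g := (InnerProductSpace.toDual ℝ E).symm)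
      (map_zero _)
  have iu := integrable_inner_of_locallyIntegrable_of_hasCompactSupport
    (hum.locallyIntegrable hp) hgc hgs
  have iv := integrable_inner_of_locallyIntegrable_of_hasCompactSupport
    (hvm.locallyIntegrable hq) hgc hgs
  simp only [Pi.add_apply, inner_add_left]
  rw [integral_add iu iv, hu θ hθ, hv θ hθ, add_zero]

/-- **Identification of a bounded duality-form mild solution in `L³` with its Oseen
representative** (Lemarié-Rieusset 2016, Thm. 6.1 with Prop. 6.5 and Lemma 6.4 (B); KNSS 2009,
§4 (i)–(ii)). Let `ν > 0`, `s < t ≤ T'`, and let `u` satisfy the two-time duality identity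
`Fluid.IsMildNSSolutionBetween ν 0 u s t` with `u(s), u(t) ∈ L³` weakly divergence free and
`‖u(τ)‖_{L³} ≤ L < ∞` on `(s, T')`; let `ū` be a bounded (`‖ū‖ ≤ M`), jointly measurable field on
`(s, T') × E` with `ū(τ) = u(τ)` a.e. for every `τ ∈ (s, T')`. Then
`u(t) = e^{ν(t-s)Δ}u(s) - B^ν_s(ū, ū)(t)` a.e., `B^ν_s = oseenDuhamel ν s`. [cite: LemarieRieusset2016, Thm. 6.1 / Prop. 6.5 and Lemma 6.4 (B)] -/
theorem ae_eq_heatExtension_sub_oseenDuhamel_of_memLp_three {ν : ℝ} (hν : 0 < ν) {s t T' : ℝ}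
    (hst : s < t) (htT : t ≤ T') {u ū : ℝ → E → E} {M : ℝ} (hM : 0 ≤ M)
    (hū : AEStronglyMeasurable (uncurry ū) (volume.restrict (Ioo s T' ×ˢ univ)))
    (hūM : ∀ τ ∈ Ioo s T', ∀ y, ‖ū τ y‖ ≤ M) (hrep : ∀ τ ∈ Ioo s T', ū τ =ᵐ[volume] u τ)
    {L : ℝ≥0∞} (hL : L < ⊤) (hK : ∀ τ ∈ Ioo s T', eLpNorm (u τ) 3 volume ≤ L)
    (hus3 : MemLp (u s) 3 volume) (hdivs : IsWeaklyDivFree (u s))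
    (hut3 : MemLp (u t) 3 volume) (hdivt : IsWeaklyDivFree (u t))
    (hmild : IsMildNSSolutionBetween ν 0 u s t) :
    u t =ᵐ[volume] fun x => UnboundedOperators.heatExtension (u s) (ν * (t - s)) x -
      oseenDuhamel ν s ū ū t x := by
  haveI : ENNReal.HolderTriple 3 (3 / 2) 1 := holderTriple_three_threeHalves_one
  have h13 : (1 : ℝ≥0∞) ≤ 3 := by norm_num
  have hθ : 0 < ν * (t - s) := mul_pos hν (sub_pos.2 hst)
  set g : E → E := fun x => UnboundedOperators.heatExtension (u s) (ν * (t - s)) x with hg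
  set B : E → E := oseenDuhamel ν s ū ū t with hB
  -- the `L³` class of the three pieces
  have hg3 : MemLp g 3 volume := UnboundedOperators.memLp_heatExtension_holds hus3 h13 hθ
  have hKū : ∀ τ ∈ Ioo s T', eLpNorm (ū τ) 3 volume ≤ L := fun τ hτ => by
    rw [eLpNorm_congr_ae (hrep τ hτ)]; exact hK τ hτ
  have hB3 : MemLp B 3 volume := by
    obtain ⟨C, -, hC⟩ := exists_eLpNorm_oseenDuhamel_le_left (E := E)
    refine ⟨aestronglyMeasurable_oseenDuhamel hν hū hū hM hūM hūM hst htT, ?_⟩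
    exact (hC hν hū hū hM hūM hūM h13 (by norm_num) hKū hst htT).trans_lt
      (ENNReal.mul_lt_top ENNReal.ofReal_lt_top hL)
  -- the difference `D = (u t - g) + B`
  set D : E → E := (u t - g) + B with hD
  have hD3 : MemLp D 3 volume := (hut3.sub hg3).add hB3
  have hdivg : IsWeaklyDivFree g := hdivs.heatExtension_of_memLp h13 hus3 hθ
  have hdivB : IsWeaklyDivFree B := isWeaklyDivFree_oseenDuhamel hν hū hū hM hūM hūM hst htT
  have hdivD : IsWeaklyDivFree D :=
    IsWeaklyDivFree.add_of_memLp' h13 h13 (hdivt.sub h13 hdivg hut3 hg3) hdivB (hut3.sub hg3) hB3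
  -- orthogonality to solenoidal tests
  have horth : ∀ φ : E → E, FunctionSpaces.IsTestFunctionOn (⊤ : Opens E) φ →
      VectorCalculus.IsDivFree φ → ∫ x, ⟪D x, φ x⟫ = 0 := by
    intro φ hφ hφdiv
    have hφc : Continuous φ := hφ.contDiff.continuous
    have hφcs : HasCompactSupport φ := hφ.hasCompactSupport
    have hφp : ∀ p : ℝ≥0∞, MemLp φ p volume := fun p => hφc.memLp_of_hasCompactSupport hφcs
    have iut : Integrable fun x => ⟪u t x, φ x⟫ :=
      integrable_inner_of_locallyIntegrable_of_hasCompactSupport (hut3.locallyIntegrable h13) hφc hφcs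
    have ig : Integrable fun x => ⟪g x, φ x⟫ :=
      integrable_inner_of_locallyIntegrable_of_hasCompactSupport (hg3.locallyIntegrable h13) hφc hφcs
    have iB : Integrable fun x => ⟪B x, φ x⟫ :=
      integrable_inner_of_locallyIntegrable_of_hasCompactSupport (hB3.locallyIntegrable h13) hφc hφcs
    have hsplit : ∫ x, ⟪D x, φ x⟫ = (∫ x, ⟪u t x, φ x⟫) - (∫ x, ⟪g x, φ x⟫) + ∫ x, ⟪B x, φ x⟫ := by
      rw [hD]
      simp only [Pi.add_apply, Pi.sub_apply, inner_add_left, inner_sub_left]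
      calc ∫ x, ⟪u t x, φ x⟫ - ⟪g x, φ x⟫ + ⟪B x, φ x⟫
          = (∫ x, ⟪u t x, φ x⟫ - ⟪g x, φ x⟫) + ∫ x, ⟪B x, φ x⟫ := integral_add (iut.sub ig) iB
        _ = _ := by rw [integral_sub iut ig]
    -- (1) the duality identity at `t`
    have h1 : ∫ x, ⟪u t x, φ x⟫ = (∫ x, ⟪u s x, heatTest ν φ (t - s) x⟫) +
        ∫ τ in s..t, ∫ x, ⟪u τ x, convect (u τ) (heatTest ν φ (t - τ)) x⟫ := by
      simpa using hmild φ hφ hφdiv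
    -- (2) the free term: symmetry of the heat semigroup
    have h2 : ∫ x, ⟪g x, φ x⟫ = ∫ x, ⟪u s x, heatTest ν φ (t - s) x⟫ := by
      rw [heatTest_of_pos hν (sub_pos.2 hst) φ, hg]
      exact (integral_inner_heatExtension_comm (p := 3) (q := 3 / 2) hus3 (hφp _) hθ).symm
    -- (3) the Duhamel term: the pairing identity, and `ū τ = u τ` a.e. for a.e. `τ`
    have h3 : ∫ x, ⟪B x, φ x⟫ = -∫ τ in s..t, ∫ x, ⟪u τ x, convect (u τ) (heatTest ν φ (t - τ)) x⟫ := by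
      rw [hB, integral_inner_oseenDuhamel_eq_neg_intervalIntegral hν hū hM hūM hst htT hφ hφdiv]
      congr 1
      refine intervalIntegral.integral_congr_ae ?_
      have hne : ∀ᵐ τ ∂(volume : Measure ℝ), τ ∉ ({t} : Set ℝ) :=
        measure_eq_zero_iff_ae_notMem.1 (measure_singleton t)
      filter_upwards [hne] with τ hτt hτ
      rw [uIoc_of_le hst.le] at hτ
      have hτt' : τ ≠ t := fun h => hτt (h ▸ mem_singleton t)
      have hτ' : τ ∈ Ioo s T' := ⟨hτ.1, (lt_of_le_of_ne hτ.2 hτt').trans_le htT⟩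
      refine integral_congr_ae ?_
      filter_upwards [hrep τ hτ'] with x hx
      simp only [convect, hx]
    rw [hsplit, h1, h2, h3]
    ring
  -- the annihilator lemma in `L³`
  have hzero := IsWeaklyDivFree.ae_eq_zero_of_memLp_of_forall_integral_inner_eq_zero
    (by norm_num : (1 : ℝ≥0∞) < 3) (by norm_num : (3 : ℝ≥0∞) < ⊤) hD3 hdivD horth
  filter_upwards [hzero] with x hx
  have hx' : (u t x - g x) + B x = 0 := hx
  rw [add_eq_zero_iff_eq_neg, sub_eq_iff_eq_add] at hx'
  rw [hx', hg, hB]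
  abel

/-- **A bounded representative by radial retraction.** If `‖u t‖_{L^∞} ≤ M` for `t ∈ S`
(`0 < M`), the retracted field `ū t x = (M / max M ‖u t x‖) • u t x` is bounded by `M`
everywhere, agrees with `u t` a.e. for every `t ∈ S`, and inherits the joint measurability of `u`
on any slab (the retraction is continuous; `BoundedRepresentative.lean`). [folklore] -/
theorem exists_retract_representative {u : ℝ → E → E} {M : ℝ} (hM : 0 < M) {S : Set ℝ}
    (hu : ∀ t ∈ S, eLpNorm (u t) ∞ volume ≤ ENNReal.ofReal M) {W : Set ℝ}
    (hmeas : AEStronglyMeasurable (uncurry u) ((volume : Measure (ℝ × E)).restrict (W ×ˢ univ))) :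
    ∃ ū : ℝ → E → E, (∀ t ∈ S, ū t =ᵐ[volume] u t) ∧ (∀ t x, ‖ū t x‖ ≤ M) ∧
      AEStronglyMeasurable (uncurry ū) ((volume : Measure (ℝ × E)).restrict (W ×ˢ univ)) := by
  set ρ : E → E := fun v => (M / max M ‖v‖) • v with hρ
  have hρc : Continuous ρ := continuous_radialRetract hM
  refine ⟨fun t x => ρ (u t x), fun t ht => ?_, fun t x => norm_radialRetract_le hM _,
    hρc.comp_aestronglyMeasurable hmeas⟩
  have hae : ∀ᵐ x ∂(volume : Measure E), ‖u t x‖ₑ ≤ ENNReal.ofReal M :=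
    (ae_le_eLpNormEssSup (f := u t)).mono fun x hx =>
      hx.trans (by rw [← eLpNorm_exponent_top]; exact hu t ht)
  filter_upwards [hae] with x hx
  have hx' : ‖u t x‖ ≤ M := by
    rw [← ofReal_norm] at hx
    exact (ENNReal.ofReal_le_ofReal_iff hM.le).1 hx
  exact radialRetract_eq_self hM hx'

/-- An `L³` field is integrable against every Gauss–Weierstrass kernel (Hölder, `G_a ∈ L^{3/2}`).
[folklore] -/
theorem integrable_heatKernel_mul_norm_of_memLp_three {f : E → E} (hf : MemLp f 3 volume)
    {a : ℝ} (ha : 0 < a) :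
    Integrable (fun y => UnboundedOperators.heatKernel a y * ‖f y‖) volume := by
  haveI : ENNReal.HolderTriple 3 (3 / 2) 1 := holderTriple_three_threeHalves_one
  have h32 : (1 : ℝ≥0∞) ≤ 3 / 2 := by
    rw [ENNReal.le_div_iff_mul_le (Or.inl two_ne_zero) (Or.inl ENNReal.ofNat_ne_top)]
    norm_num
  have hG : MemLp (UnboundedOperators.heatKernel (E := E) a) (3 / 2) volume :=
    UnboundedOperators.memLp_heatKernel ha h32
  have h1 : MemLp (fun y => ‖f y‖ * ‖UnboundedOperators.heatKernel a y‖) 1 volume :=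
    hG.norm.mul' hf.norm
  refine (memLp_one_iff_integrable.1 h1).congr (Eventually.of_forall fun y => ?_)
  dsimp only
  rw [Real.norm_of_nonneg (UnboundedOperators.heatKernel_pos ha y).le, mul_comm]

end Identification

/-! ## The reduction `knss2009_smoothing ℝ³ → classical_of_bounded_mild_L3` -/

section Assembly


/-- **Step 1–2: the Oseen integral equation from every positive time**, a.e., for a mild
`C([0,T); L³)` solution essentially bounded on interior strips (restart at the duality level,
`mild_L3_restart_holds`, and identification in `L³`,
`ae_eq_heatExtension_sub_oseenDuhamel_of_memLp_three`, on the window `(s, (t+T)/2)` with a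
retracted bounded representative, which the Duhamel term does not see). [cite: LemarieRieusset2016, Thm. 6.1 / Prop. 6.5 and Thm. 15.1 (A) (proof)] -/
theorem ae_eq_heatExtension_sub_oseenDuhamel_of_mild_L3 {ν T : ℝ} (hν : 0 < ν) (hT : 0 < T)
    {u₀ : (EuclideanSpace ℝ (Fin 3)) → (EuclideanSpace ℝ (Fin 3))} {v : ℝ → (EuclideanSpace ℝ (Fin 3)) → (EuclideanSpace ℝ (Fin 3))} (hu₀ : MemLp u₀ 3 volume)
    (hv : IsMildNSSolutionOn (Ico 0 T) ν 0 u₀ v) (hvc : ContinuousInLpOn (Ico 0 T) 3 v)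
    (hmeas : AEStronglyMeasurable (uncurry v) (volume.restrict (Ioo 0 T ×ˢ univ)))
    (hwin : ∀ ⦃s T₁ : ℝ⦄, 0 < s → s ≤ T₁ → T₁ < T → ∃ M : ℝ, 0 < M ∧
      ∀ t ∈ Icc s T₁, eLpNorm (v t) ∞ volume ≤ ENNReal.ofReal M)
    ⦃s t : ℝ⦄ (hs : 0 < s) (hst : s < t) (htT : t < T) :
    v t =ᵐ[volume] fun x =>
      UnboundedOperators.heatExtension (v s) (ν * (t - s)) x - oseenDuhamel ν s v v t x := by
  have h13 : (1 : ℝ≥0∞) ≤ 3 := by norm_num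
  set T₁ : ℝ := (t + T) / 2 with hT₁
  have htT₁ : t < T₁ := by rw [hT₁]; linarith
  have hT₁T : T₁ < T := by rw [hT₁]; linarith
  obtain ⟨M, hM, hMb⟩ := hwin hs (hst.trans htT₁).le hT₁T
  obtain ⟨ū, hūv, hūM, hūmeas⟩ :=
    exists_retract_representative (S := Icc s T₁) (W := Ioo 0 T) hM hMb hmeas
  have hūw : AEStronglyMeasurable (uncurry ū) (volume.restrict (Ioo s T₁ ×ˢ univ)) :=
    hūmeas.mono_measure
      (Measure.restrict_mono (prod_mono (Ioo_subset_Ioo hs.le hT₁T.le) Subset.rfl) le_rfl)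
  have hrep : ∀ τ ∈ Ioo s T₁, ū τ =ᵐ[volume] v τ := fun τ hτ => hūv τ ⟨hτ.1.le, hτ.2.le⟩
  obtain ⟨L, hL⟩ := ContinuousInLpOn.exists_forall_eLpNorm_le hvc h13 isCompact_Icc
    (show Icc 0 T₁ ⊆ Ico 0 T from fun τ hτ => ⟨hτ.1, hτ.2.trans_lt hT₁T⟩)
  have hK : ∀ τ ∈ Ioo s T₁, eLpNorm (v τ) 3 volume ≤ (L : ℝ≥0∞) := fun τ hτ =>
    hL τ ⟨(hs.trans hτ.1).le, hτ.2.le⟩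
  have hsT : s ∈ Ico 0 T := ⟨hs.le, hst.trans htT⟩
  have htT' : t ∈ Ico 0 T := ⟨(hs.trans hst).le, htT⟩
  have hid := ae_eq_heatExtension_sub_oseenDuhamel_of_memLp_three hν hst htT₁.le hM.le hūw
    (fun τ _ y => hūM τ y) hrep ENNReal.coe_lt_top hK (hvc.1 s hsT) (hv.1 s hsT)
    (hvc.1 t htT') (hv.1 t htT') (mild_L3_restart_holds hν hT hu₀ hv hvc hmeas hs.le hst.le htT)
  have hcongr : ∀ x, oseenDuhamel ν s ū ū t x = oseenDuhamel ν s v v t x := fun x =>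
    oseenDuhamel_congr_ae_slice (fun τ hτ => hrep τ ⟨hτ.1, hτ.2.trans htT₁⟩)
      (fun τ hτ => hrep τ ⟨hτ.1, hτ.2.trans htT₁⟩) x
  filter_upwards [hid] with x hx
  rw [hx, hcongr x]

/-- **Step 3: a jointly smooth representative on `(0, T) × ℝ³`** from fact (P) on the windows
`(s, T₁)` and the gluing of continuous representatives (`v'(t) = w_{t/2}(t)`). [cite: KochNadirashviliSereginSverak2009, Prop. 4.1 (arXiv:0709.3599 p. 8)] -/
theorem exists_smooth_representative_of_mild_L3 (hP : knss2009_smoothing (EuclideanSpace ℝ (Fin 3))) {ν T : ℝ}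
    (hν : 0 < ν) (hT : 0 < T) {u₀ : (EuclideanSpace ℝ (Fin 3)) → (EuclideanSpace ℝ (Fin 3))} {v : ℝ → (EuclideanSpace ℝ (Fin 3)) → (EuclideanSpace ℝ (Fin 3))} (hu₀ : MemLp u₀ 3 volume)
    (hv : IsMildNSSolutionOn (Ico 0 T) ν 0 u₀ v) (hvc : ContinuousInLpOn (Ico 0 T) 3 v)
    (hmeas : AEStronglyMeasurable (uncurry v) (volume.restrict (Ioo 0 T ×ˢ univ)))
    (hwin : ∀ ⦃s T₁ : ℝ⦄, 0 < s → s ≤ T₁ → T₁ < T → ∃ M : ℝ, 0 < M ∧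
      ∀ t ∈ Icc s T₁, eLpNorm (v t) ∞ volume ≤ ENNReal.ofReal M) :
    ∃ v' : ℝ → (EuclideanSpace ℝ (Fin 3)) → (EuclideanSpace ℝ (Fin 3)), IsSmoothSpaceTimeOn (Ioo 0 T) v' ∧ ∀ t ∈ Ioo 0 T, v' t =ᵐ[volume] v t := by
  have hR' := ae_eq_heatExtension_sub_oseenDuhamel_of_mild_L3 hν hT hu₀ hv hvc hmeas hwin
  -- the smooth representatives `w s` on `(s, T₁) × ℝ³`, by (P)
  set w : ℝ → ℝ → (EuclideanSpace ℝ (Fin 3)) → (EuclideanSpace ℝ (Fin 3)) := fun s t x =>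
    UnboundedOperators.heatExtension (v s) (ν * (t - s)) x - oseenDuhamel ν s v v t x with hw
  have hP' : ∀ ⦃s T₁ : ℝ⦄, 0 < s → s < T₁ → T₁ < T → IsSmoothSpaceTimeOn (Ioo s T₁) (w s) := by
    intro s T₁ hs hsT₁ hT₁
    obtain ⟨M, hM, hMb⟩ := hwin hs hsT₁.le hT₁
    have hmeas_s : AEStronglyMeasurable (uncurry v) (volume.restrict (Ioo s T₁ ×ˢ univ)) :=
      hmeas.mono_measure
        (Measure.restrict_mono (prod_mono (Ioo_subset_Ioo hs.le hT₁.le) Subset.rfl) le_rfl)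
    have hsl : AEStronglyMeasurable (v s) volume := (hvc.1 s ⟨hs.le, hsT₁.trans hT₁⟩).1
    exact (hP hν hsT₁ hM.le hsl (hMb s ⟨le_rfl, hsT₁.le⟩) hmeas_s
      (fun t ht => hMb t ⟨ht.1.le, ht.2.le⟩) (fun t ht => hR' hs ht.1 (ht.2.trans hT₁))).1
  -- `w s t = v t` a.e., and slices of `w s` are continuous
  have hwu : ∀ ⦃s t : ℝ⦄, 0 < s → s < t → t < T → w s t =ᵐ[volume] v t :=
    fun s t hs hst htT => (hR' hs hst htT).symm
  have hwcont : ∀ ⦃s t : ℝ⦄, 0 < s → s < t → t < T → Continuous (w s t) := by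
    intro s t hs hst htT
    have h1 := hP' hs (show s < (t + T) / 2 by linarith) (by linarith)
    exact (h1.contDiff_slice ⟨hst, by linarith⟩).continuous
  have hagree : ∀ ⦃s s' t : ℝ⦄, 0 < s → s < t → 0 < s' → s' < t → t < T → w s t = w s' t :=
    fun s s' t hs hst hs' hs't htT =>
      eq_of_ae_eq_of_continuous (hwcont hs hst htT) (hwcont hs' hs't htT)
        ((hwu hs hst htT).trans (hwu hs' hs't htT).symm)
  -- the global representative
  set v' : ℝ → (EuclideanSpace ℝ (Fin 3)) → (EuclideanSpace ℝ (Fin 3)) := fun t => w (t / 2) t with hv'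
  have hvw : ∀ ⦃s t : ℝ⦄, 0 < s → s < t → t < T → v' t = w s t := fun s t hs hst htT =>
    hagree (half_pos (hs.trans hst)) (half_lt_self (hs.trans hst)) hs hst htT
  have hvu : ∀ t ∈ Ioo 0 T, v' t =ᵐ[volume] v t := fun t ht =>
    hwu (half_pos ht.1) (half_lt_self ht.1) ht.2
  refine ⟨v', ?_, hvu⟩
  refine contDiffOn_of_locally_contDiffOn fun z hz => ?_
  obtain ⟨ht, -⟩ := mem_prod.1 hz
  set s : ℝ := z.1 / 2 with hs
  set T₁ : ℝ := (z.1 + T) / 2 with hT₁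
  have hs0 : 0 < s := half_pos ht.1
  have hsz : s < z.1 := half_lt_self ht.1
  have hzT₁ : z.1 < T₁ := by rw [hT₁]; linarith [ht.2]
  have hT₁T : T₁ < T := by rw [hT₁]; linarith [ht.2]
  refine ⟨Ioo s T₁ ×ˢ univ, (isOpen_Ioo.prod isOpen_univ), mk_mem_prod ⟨hsz, hzT₁⟩ (mem_univ _),
    ?_⟩
  have hsub : (Ioo 0 T ×ˢ (univ : Set (EuclideanSpace ℝ (Fin 3)))) ∩ Ioo s T₁ ×ˢ univ = Ioo s T₁ ×ˢ univ := by
    rw [inter_eq_right]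
    exact prod_mono (Ioo_subset_Ioo hs0.le hT₁T.le) Subset.rfl
  rw [hsub]
  refine (hP' hs0 (hsz.trans hzT₁) hT₁T).congr fun y hy => ?_
  obtain ⟨hy1, -⟩ := mem_prod.1 hy
  change v' y.1 y.2 = w s y.1 y.2
  rw [hvw hs0 hy1.1 (hy1.2.trans hT₁T)]

/-- **Step 4: classical on `(δ, T)` through the time shift and fact (C).** For a jointly smooth
representative `v'` of the mild solution, the shifted field `v'(· + δ)`, `0 < δ < T`, is a
classical solution on `(0, T - δ)` for some smooth pressure (`classical_of_smooth_isMildNSSolutionOn_holds`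
applied to the duality-form mild solution from the datum `v(δ) ∈ L³`,
`isMildNSSolutionOn_translate_of_restart`). [cite: LemarieRieusset2016, Thm. 15.1 (A) (proof, p. 565)] -/
theorem exists_isClassicalNSSolutionOn_shift_of_mild_L3 {ν T : ℝ} (hν : 0 < ν) (hT : 0 < T)
    {u₀ : (EuclideanSpace ℝ (Fin 3)) → (EuclideanSpace ℝ (Fin 3))} {v : ℝ → (EuclideanSpace ℝ (Fin 3)) → (EuclideanSpace ℝ (Fin 3))} (hu₀ : MemLp u₀ 3 volume)
    (hv : IsMildNSSolutionOn (Ico 0 T) ν 0 u₀ v) (hvc : ContinuousInLpOn (Ico 0 T) 3 v)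
    (hmeas : AEStronglyMeasurable (uncurry v) (volume.restrict (Ioo 0 T ×ˢ univ)))
    (hwin : ∀ ⦃s T₁ : ℝ⦄, 0 < s → s ≤ T₁ → T₁ < T → ∃ M : ℝ, 0 < M ∧
      ∀ t ∈ Icc s T₁, eLpNorm (v t) ∞ volume ≤ ENNReal.ofReal M)
    {v' : ℝ → (EuclideanSpace ℝ (Fin 3)) → (EuclideanSpace ℝ (Fin 3))} (hvsmooth : IsSmoothSpaceTimeOn (Ioo 0 T) v')
    (hvu : ∀ t ∈ Ioo 0 T, v' t =ᵐ[volume] v t) ⦃δ : ℝ⦄ (hδ : 0 < δ) (hδT : δ < T) :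
    ∃ p : ℝ → (EuclideanSpace ℝ (Fin 3)) → ℝ, IsClassicalNSSolutionOn (Ioo 0 (T - δ)) ν 0 (fun t => v' (t + δ)) p := by
  have hδ' : δ ∈ Ico 0 T := ⟨hδ.le, hδT⟩
  have hTδ : 0 < T - δ := sub_pos.2 hδT
  have hd3 : MemLp (v δ) 3 volume := hvc.1 δ hδ'
  have hsm : IsSmoothSpaceTimeOn (Ioo 0 (T - δ)) (fun t => v' (t + δ)) :=
    (hvsmooth.comp_add_right δ).mono fun t ht => ⟨by linarith [ht.1], by linarith [ht.2]⟩
  have hbd : ∀ T₁ ∈ Ioo 0 (T - δ), ∃ C : ℝ≥0∞, C < ∞ ∧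
      ∀ t ∈ Ioo 0 T₁, eLpNorm (v' (t + δ)) ∞ volume ≤ C := by
    intro T₁ hT₁
    obtain ⟨M, hM, hMb⟩ := hwin hδ (by linarith [hT₁.1] : δ ≤ T₁ + δ) (by linarith [hT₁.2])
    refine ⟨ENNReal.ofReal M, ENNReal.ofReal_lt_top, fun t ht => ?_⟩
    have htδ : t + δ ∈ Ioo 0 T := ⟨by linarith [ht.1], by linarith [ht.2, hT₁.2]⟩
    rw [eLpNorm_congr_ae (hvu (t + δ) htδ)]
    exact hMb (t + δ) ⟨by linarith [ht.1], by linarith [ht.2]⟩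
  have hmild : IsMildNSSolutionOn (Ioo 0 (T - δ)) ν 0 (v δ) (fun t => v' (t + δ)) := by
    have h := (isMildNSSolutionOn_translate_of_restart mild_L3_restart_holds hν hT hu₀ hv hvc
      hmeas hδ').mono Ioo_subset_Ico_self
    exact IsMildNSSolutionOn.congr_ae_Ioo h fun t ht =>
      hvu (t + δ) ⟨by linarith [ht.1], by linarith [ht.2]⟩
  exact classical_of_smooth_isMildNSSolutionOn_holds (E := (EuclideanSpace ℝ (Fin 3))) hν hTδ hd3.1
    (fun a ha => integrable_heatKernel_mul_norm_of_memLp_three hd3 ha) hsm hbd hmild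

/-- **`classical_of_bounded_mild_L3` from KNSS's smoothing fact (P).** For a mild solution
`v ∈ C([0,T); L³)` in the duality form from `u₀ ∈ L³`, essentially bounded on interior strips:
restart at the duality level (`mild_L3_restart_holds`), identification with the Oseen
representative on every window `(s, T₁)`, `0 < s`, joint smoothness of the representatives by
`knss2009_smoothing`, gluing of the continuous representatives into `v'`, the tested momentum
equation at each `t₀` through the time-shifted field `v'(· + t₀/2)` and fact (C)
(`classical_of_smooth_isMildNSSolutionOn_holds`), and the global pressure by
`PressureReconstruction.lean`. (Lemarié-Rieusset 2016, proof of Thm. 15.1 (A), p. 565, with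
Thm. 9.12; KNSS 2009, Prop. 4.1; Giga 1986, Remark after Thm. 4.) [cite: LemarieRieusset2016, Thm. 9.12 and Thm. 15.1 (A) (proof, p. 565)] -/
theorem classical_of_bounded_mild_L3_of_knss2009_smoothing (hP : knss2009_smoothing (EuclideanSpace ℝ (Fin 3))) :
    classical_of_bounded_mild_L3 := by
  intro ν T hν hT u₀ v hu₀ _hdiv₀ hv hvc hmeas hbdd
  -- uniform essential bound on a closed window `[s, T₁] ⊂ (0, T)`
  have hwin : ∀ ⦃s T₁ : ℝ⦄, 0 < s → s ≤ T₁ → T₁ < T → ∃ M : ℝ, 0 < M ∧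
      ∀ t ∈ Icc s T₁, eLpNorm (v t) ∞ volume ≤ ENNReal.ofReal M := by
    intro s T₁ hs hsT₁ hT₁
    obtain ⟨C, hC⟩ := hbdd (s / 2) ((T₁ + T) / 2) (half_pos hs) (by linarith) (by linarith)
    refine ⟨max C 0 + 1, by positivity, fun t ht =>
      (hC t ⟨by linarith [ht.1], by linarith [ht.2]⟩).trans ?_⟩
    exact ENNReal.ofReal_le_ofReal (by linarith [le_max_left C 0])
  obtain ⟨v', hvsmooth, hvu⟩ := exists_smooth_representative_of_mild_L3 hP hν hT hu₀ hv hvc hmeas hwin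
  have hshift := exists_isClassicalNSSolutionOn_shift_of_mild_L3 hν hT hu₀ hv hvc hmeas hwin
    hvsmooth hvu
  -- `div v' = 0`
  have hdivv : ∀ t ∈ Ioo 0 T, VectorCalculus.IsDivFree (v' t) := by
    intro t ht
    obtain ⟨p, hcl⟩ := hshift (half_pos ht.1) ((half_lt_self ht.1).trans ht.2)
    have h := hcl.divFree (t / 2) ⟨half_pos ht.1, by linarith [ht.2]⟩
    have ht2 : t / 2 + t / 2 = t := by ring
    simpa only [ht2] using h
  -- the momentum equation against solenoidal tests at every `t ∈ (0, T)`
  have hf : IsSmoothSpaceTimeOn (Ioo 0 T) (0 : ℝ → (EuclideanSpace ℝ (Fin 3)) → (EuclideanSpace ℝ (Fin 3))) := contDiffOn_const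
  have horth : ∀ t ∈ Ioo 0 T, ∀ φ : (EuclideanSpace ℝ (Fin 3)) → (EuclideanSpace ℝ (Fin 3)), FunctionSpaces.IsTestFunctionOn (⊤ : Opens (EuclideanSpace ℝ (Fin 3))) φ →
      VectorCalculus.IsDivFree φ →
        ∫ x, ⟪timeDerivWithin (Ioo 0 T) v' t x + convect (v' t) (v' t) x - ν • (Δ (v' t)) x -
          (0 : ℝ → (EuclideanSpace ℝ (Fin 3)) → (EuclideanSpace ℝ (Fin 3))) t x, φ x⟫ = 0 := by
    intro t ht φ hφ hφdiv
    set δ : ℝ := t / 2 with hδ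
    have hδ0 : 0 < δ := half_pos ht.1
    have hδT : δ < T := (half_lt_self ht.1).trans ht.2
    obtain ⟨p, hcl⟩ := hshift hδ0 hδT
    have ht' : t - δ ∈ Ioo 0 (T - δ) := ⟨by rw [hδ]; linarith [ht.1], by linarith [ht.2]⟩
    have htδ : t - δ + δ = t := sub_add_cancel t δ
    -- the time derivative within an open time set is local and translates
    have hder : ∀ x, timeDerivWithin (Ioo 0 (T - δ)) (fun τ => v' (τ + δ)) (t - δ) x =
        timeDerivWithin (Ioo 0 T) v' t x := by
      intro x
      simp only [timeDerivWithin_apply]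
      rw [derivWithin_of_isOpen isOpen_Ioo ht', derivWithin_of_isOpen isOpen_Ioo ht,
        deriv_comp_add_const (fun τ => v' τ x) δ (t - δ), htδ]
    have hmom := fun x => hcl.momentum (t - δ) ht' x
    simp only [hder, htδ, Pi.zero_apply, add_zero] at hmom
    -- `G = -∇p`, which pairs to zero against the solenoidal test
    have hG : ∀ x, timeDerivWithin (Ioo 0 T) v' t x + convect (v' t) (v' t) x - ν • (Δ (v' t)) x -
        (0 : ℝ → (EuclideanSpace ℝ (Fin 3)) → (EuclideanSpace ℝ (Fin 3))) t x = -gradient (p (t - δ)) x := by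
      intro x
      rw [hmom x]
      simp only [Pi.zero_apply, sub_zero]
      abel
    simp_rw [hG, inner_neg_left, MeasureTheory.integral_neg, neg_eq_zero]
    have hpc : ContDiff ℝ (⊤ : ℕ∞) (p (t - δ)) := hcl.contDiff_pressure ht'
    simp_rw [real_inner_comm (φ _), inner_gradient_eq_fderiv_apply]
    exact integral_fderiv_apply_eq_zero_of_isDivFree_test hφ hφdiv hpc
  -- the pressure on all of `(0, T)`
  obtain ⟨π, hcl⟩ := exists_isClassicalNSSolutionOn_of_forall_integral_inner_eq_zero isOpen_Ioo
    hvsmooth hf hdivv horth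
  exact ⟨v', π, hcl, fun t ht => hvu t ht⟩

/-- **`classical_of_bounded_mild_L3` from the local theory (L) alone.** With the restart fact
(R) discharged (`oseenMild_restart_holds`) and (P) reduced to (L) (`knss2009_smoothing_of_local`),
the fact `classical_of_bounded_mild_L3` (Lemarié-Rieusset 2016, Thm. 9.12 in the form used on
p. 565) follows from the single named fact (L) `knss2009_local_smoothing ℝ³` (KNSS 2009,
Prop. 4.1 in its quantitative short-time form). [cite: LemarieRieusset2016, Thm. 9.12; KochNadirashviliSereginSverak2009, Prop. 4.1 (arXiv:0709.3599 p. 8)] -/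
theorem classical_of_bounded_mild_L3_of_local
    (hL : knss2009_local_smoothing (EuclideanSpace ℝ (Fin 3))) : classical_of_bounded_mild_L3 :=
  classical_of_bounded_mild_L3_of_knss2009_smoothing
    (knss2009_smoothing_of_local (oseenMild_restart_holds (EuclideanSpace ℝ (Fin 3))) hL)

end Assembly

end Literature.Analysis.FluidPDE
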